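import Mathlib
import HarnessLib
import HarnessLib.Audit
import Summits.AtomisticToContinuum.Statement
import Literature.MathematicalPhysics.KineticTheory.LangevinChainNESSHolds
import Summits.AtomisticToContinuum.FouriersLaw.Theorems.EmbeddedDrudeMourreNessUnique
import Summits.AtomisticToContinuum.FouriersLaw.Theorems.FourierGreenKuboFourierFiniteResponseOfUnique
import HarnessLib.Audit.Status.Attr

/-!
Route: VanishingNoiseTransfer

DORMANT since 2026-08-24T01:20:31Z (reconciler: no traction for 6.4 d (last activity item-evidence-added at 2026-08-17T14:55:26Z); parked, not closed — `ledger route dormant route-AtomisticToContinuum-VanishingNoiseTransfer --off` to re) — unstaffed, not closed; items shared with open routes are served there. `ledger route dormant <id> --off` reactivates.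

# Route VanishingNoiseTransfer — noise homotopy — an N-uniform modulus of the open-chain resistivity
in velocity-flip noise transfers noisy Fourier to ε = 0; κ < ∞ = one ε-uniform bound at positive
noise; closes proved

D-0027 §2.1-conforming re-open of the retired gen-1 route NoiseHomotopyTransfer (closed 2026-08-15
`not-a-thesis` only because its
assembly concluded the Literature constant and no deciding theorem existed; same three cruxes,
reviewed rc0/accurate by refuter a1bd204f-0),
now with `theorem closes … : _root_.FouriersLaw` PROVED sorry-free by the planner (Sketch.lean rc 0,
axioms propext/Classical.choice/Quot.sound).
Realises card noise-homotopy-russo-transfer (graded new-combination, two audits). Embed the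
conjunct's chain in the family L_ε = L + εS,
S f = Σ_i (f∘Θ_i − f) the independent velocity flips p_i ↦ −p_i at every site (energy-conserving
bulk noise, BernardinOlla2011 §2.1), with
the SAME Langevin baths, and let D_N(ε) be the BLR response coefficient of the noisy N-chain (D_N(0)
is the conjunct's). It suffices to
show X = X1 ∧ X2 ∧ X3 (plus the two shared print-level supports): X1 NoiseLocality — an N-UNIFORM
modulus w(ε) → 0 (ε ↓ 0) with
|1/D_N(ε) − 1/D_N(0)| ≤ w(ε) for all N and ε ∈ (0,1] (filed division-free: |D_N(0) − D_N(ε)| ≤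
w(ε)|D_N(0)||D_N(ε)|); X2
VanishingNoiseBound — the noisy conductivities κ_ε(T) = lim_N D_N(ε) stay bounded as ε ↓ 0 (given
X1, X3: ONE strict inequality
1/κ_{ε₀}(T) > w(ε₀) at ONE positive noise level); X3 NoisyFourier — FouriersLawFor verbatim (both
clauses) for the flip-noisy chain at
every ε > 0. Then (planner-proved transfer, pure real analysis): for ε ≤ min(ε₁,1) and N ≥ N_ε,
D_N(ε) > κ_ε/2 > 0 forces D_N(0) ≠ 0
and |1/D_N(0) − 1/D_N(ε)| ≤ w(ε); so r_N := 1/D_N(0) is Cauchy (oscillation ≤ 2w(ε) + o(1) for every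
admissible ε), r_N → r₀ with
r₀ ≥ 1/K − w(ε) for all small ε, hence r₀ ≥ 1/K > 0 and D_N(0) → κ(T) := 1/r₀ ∈ (0,∞) — clause (ii),
for EVERY steady family since by
NessUnique its response quotients coincide with the reference family's for |δ| < 2T; clause (i) from
the landed theorem
Literature.MathematicalPhysics.KineticTheory.HeatConduction.pinnedChain_exists_isSteadyState +
NessUnique. No exchange of the limits
ε → 0, N → ∞ is performed anywhere: the N-uniform modulus commutes with N → ∞ by itself.
Lean: `NoiseLocality ∧ VanishingNoiseBound ∧ NoisyFourier ∧ NessUnique ∧ FiniteResponseOfUnique`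

## Assembly
DECIDING THEOREM (D-0027 §2.1), supplied with `--closes-file glue.lean` and PROVED sorry-free
(planner Sketch.lean rc 0, ≈ 190 lines,
axioms propext / Classical.choice / Quot.sound): `theorem closes (hNL : NoiseLocality) (hVB :
VanishingNoiseBound) (hNF : NoisyFourier)
(hNU : NessUnique) (hFR : FiniteResponseOfUnique) : _root_.FouriersLaw` — hypotheses are five of
this route's own items, conclusion the
sub-problem Statement decl itself. Proof: (0) an inner `transfer` lemma of pure real analysis — if
for every ε ∈ (0, ε₁] there are
k_ε ∈ (0, K] and D^ε_N → k_ε with |D⁰_N − D^ε_N| ≤ w(ε)|D⁰_N||D^ε_N| for all N, and w → 0 at 0⁺,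
then D⁰_N → L ∈ (0,∞) (eventually
D^ε_N > k_ε/2 forces D⁰_N ≠ 0 and |1/D⁰_N − 1/k_ε| < |w(ε)| + η; 1/D⁰_N is Cauchy; its limit r₀ ≥
1/K − η for every η; L = 1/r₀);
(1) clause (i) from pinnedChain_exists_isSteadyState + NessUnique; (2) clause (ii): a reference
steady family by choice, its D⁰_N(T)
from FiniteResponseOfUnique, the three cruxes instantiated at S := the inlined flip predicate
(`rfl`), the unique noisy family chosen from
NoisyFourier (i), its responses and κ_ε(T) > 0 from NoisyFourier (ii), κ_ε(T) ≤ K from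
VanishingNoiseBound, the modulus from
NoiseLocality at each N, `transfer` ⇒ κ(T) := L (κ := 1 at T ≤ 0); an arbitrary steady family has
the same response quotients on
|δ| < 2T by NessUnique (`Tendsto.congr'`). The optional Assembly ITEM records the same implication
as a Prop (its witness is `closes`).

Rationale: WHY THIS LINE. The one setting in which the heat-conduction programme WORKS is the oscillator chain
with energy-conserving bulk noise (BernardinOlla2005,
BernardinOlla2011 Thm 2–3, OllaSasada2012, Bernardin2014, LiveraniOlla2011 at weak coupling), and
the catalogued barrier
HasBoundedResponse records exactly that this evasion "does not reach the deterministic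
boundary-driven chain"; the vanishing-noise
question is posed in BernardinHuveneersLebowitzLiveraniOlla2015 §1 and treated there only by formal
expansions at fixed noise, and
numerically in IacobucciEtAl2010 (Toda vs. FPU). This line supplies the missing transfer as a
one-line real-analysis device imported
from nowhere deeper than Moore–Osgood: an N-uniform modulus of continuity of the finite-N open-chain
resistivity in the noise strength (X1,
expected from a Russo-type sitewise derivative formula — fixed-N smooth perturbation theory of the
hypoelliptic generator by bounded flip
kernels, HairerMajda2009 — with a locality bound "one extra scatterer changes the total resistance
(N−1)r_N by O(1)") commutes with N → ∞,
so noisy Fourier (X3; interacting-particle-systems probability: KLO/Sethuraman variational formulas,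
non-gradient two-block estimates,
entropy production, KipnisLandim1999) passes to ε = 0, existence and positivity of κ(0) come for
free, and the whole anti-ballistic
difficulty is relocated to X2, an ε-uniform bound on conductivities of NOISY chains where
variational calculus is available (one strict
test-function inequality at one ε₀ once w is explicit). The only physical heuristic used (not
load-bearing) is Matthiessen/Kohler
"resistivities of independent scatterers add". Versus the open routes of the sub: FourierGreenKubo
needs C_T ∈ L¹ for the infinite
DETERMINISTIC chain; CurrentTiltQuench / OddSectorIrreversibility / KineticCorner /
PorousMediumCorner / BondHeatUncertainty work at ε = 0
throughout; here the deterministic chain is never studied in infinite volume and no ε = 0 Green–Kubo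
object appears — shared are only the
print-level supports NessUnique / FiniteResponseOfUnique (stmt-0741/0717). Negatives index (6
refuted statements of the summit, none
in FouriersLaw): nothing to steer around.

RANKED CRUXES. #2 NoiseLocality (crux) — NOISE LOCALITY (card item 2, modulus form; verbatim
re-filing of stmt-AtomisticToContinuum-3112). Noisy chain := pinnedChain ω₂ lam β γ between the same
Langevin baths PLUS independent velocity flips p_i ↦ −p_i at every site at rate ε (generator L + εS,
BernardinOlla2011 §2.1); weak noisy steady state := probability measure with ∫ (L f + ε S f) dμ = 0
for f ∈ C_c^∞ and integrable bond currents (flips carry no energy current, so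
bondCurrent/totalCurrent are the deterministic functionals; at ε = 0 this is IsSteadyState
verbatim); the predicate is bound once as S with a defining equation. CLAIM: for all parameters > 0
and T > 0 there is a modulus w, w(ε) → 0 as ε ↓ 0, UNIFORM IN N, such that for every N, every ε ∈
(0,1], the unique deterministic steady family μ⁰ and the unique noisy family μ^ε at this N and their
response coefficients D⁰, D^ε at T: |D⁰ − D^ε| ≤ w(ε)·|D⁰|·|D^ε| (division-free |1/D_N(ε) −
1/D_N(0)| ≤ w(ε); it forces D_N(0) ≠ 0 wherever D_N(ε) ≠ 0 — the prover supplies D_N(0) ≠ 0 for N ≥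
2 — and one takes w ≥ 0). Expected proof output w = C(T)ε from a Russo-type derivative formula
∂_ε(1/D_N) = Σ_x ∂(1/D_N)/∂ε_x with the sitewise bound |∂(1/D_N)/∂ε_x| ≤ C/(N−1); a heavy
current-autocorrelation tail only degrades the modulus (t^{−3/2} tail ⇒ w ≍ √ε), which this form
tolerates. Holds in the ballistic harmonic corner (r_N(0) → 0, r_N(ε) → cε), fails under
localisation. [difficulty: XL] (why it might fail: N-uniform equicontinuity at ε = 0⁺ carries the
'limit exists' half of Fourier's law: false if D_N(0) oscillates in N while each D_N(ε) converges;
the sitewise response is a space-time NESS correlation with no N-uniform bound in print (breathers,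
low-T near-integrable phonons).) [BernardinOlla2011, BernardinHuveneersLebowitzLiveraniOlla2015,
HairerMajda2009, BernardinHuveneers2013, IacobucciEtAl2010, Spohn2014, LepriLiviPoliti2003]
#3 VanishingNoiseBound (crux) — VANISHING-NOISE BOUND (card item 4 'StrictNoisyBound' in closed
form; verbatim re-filing of stmt-AtomisticToContinuum-3113; S = the flip-noisy steady-state
predicate of NoiseLocality). CLAIM: for all parameters > 0 and T > 0 there are K and ε₁ > 0 such
that for every ε ∈ (0, ε₁], the unique noisy steady family at rate ε, every sequence D_N(ε) of its
response coefficients at T and every limit k = lim_N D_N(ε): k ≤ K — the noisy conductivities κ_ε(T)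
stay bounded as the noise vanishes. This is where κ(0) < ∞ lives: given NoiseLocality (modulus w)
and NoisyFourier, |r₀ − 1/κ_ε| ≤ w(ε), so the item ⇔ r₀ > 0 ⇔ there is ONE ε₀ ∈ (0,1] with
1/κ_{ε₀}(T) > w(ε₀). Operational form once w is explicit (foreseen split): certify κ_{ε₀}(T) <
1/w(ε₀) by the Kipnis–Landim–Olla / Sethuraman inf-variational formula for the NOISY infinite chain,
whose symmetric part εS is a bounded Dirichlet form non-degenerate in the momenta (BernardinOlla2011
eq. (var); their Prop 4 with f = −V(r₁)/2 gives only κ_ε(T) ≤ Var(V′)/(4εT), i.e. ON the harmonic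
line c/ε — one must beat 1/ε once with a test function encoding anharmonic scattering; the Gibbs
integrals are 1-D transfer-operator quantities). Fails, as it must, for the harmonic chain (κ_ε =
1/(4ε)-type law, BernardinOlla2011 Thm 3) and for a chain with a flip-non-invariant hidden conserved
quantity (Mazur: κ_ε ≳ 1/ε; numerically Toda + conservative noise stays anomalous,
IacobucciEtAl2010); with NoiseLocality it implies HasBoundedResponse(pinnedChain). [deps:
NoiseLocality, NoisyFourier] [difficulty: open-problem] (why it might fail: ε-uniform control of
noise-regularised conductivities as noise → 0 is BHLLO2015's open question; every printed
variational bound is O(1/ε) (BO2011 Prop 4); beating 1/ε needs an approximate deterministic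
corrector, possibly GreenKubo-hard; noise may even suppress nonlinear scattering (ILOS2010).)
[BernardinOlla2011, BernardinHuveneersLebowitzLiveraniOlla2015, Bernardin2014, KipnisLandim1999,
IacobucciEtAl2010, BonettoLebowitzReyBellet2000,
Literature.Barriers.AtomisticToContinuum.HasBoundedResponse,
Literature.Barriers.AtomisticToContinuum.Mazur.Mazur1969_inequality]
#4 NoisyFourier (crux) — NOISY FOURIER LAW (card item 3; verbatim re-filing of
stmt-AtomisticToContinuum-3114; S as above). CLAIM: for all parameters > 0 and EVERY flip rate ε >
0, OscillatorChain.FouriersLawFor verbatim for the noisy chain: (i) for all N and T_L, T_R > 0 the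
weak steady state of L + εS exists and is unique; (ii) there is κ_ε : ℝ → ℝ with κ_ε(T) > 0 for T >
0 such that for every noisy steady family and every T > 0 the response limits D_N(ε) = lim_{δ→0,
δ≠0} totalCurrent(μ_{N,T+δ/2,T−δ/2})/δ exist for all N and D_N(ε) → κ_ε(T). Print: NESS
existence/uniqueness for anharmonic chain + flips + Langevin baths (BernardinOlla2011 Prop 1,
unpinned with tension; pinned: CuneoEckmannHairerReyBellet2018 Lyapunov/Harris machinery + bounded
jump perturbation + Echeverría-type identification of weak solutions of the jump-diffusion
Fokker–Planck equation); Green–Kubo limit exists with flips (BernardinOlla2011 Thm 2) with two-sided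
bounds (Props 4–8); Fourier's law IN THE NESS only for the harmonic bulk (BernardinOlla2011 Thm 3:
lim n J_s = (T_ℓ − T_r)/(4γ); BernardinOlla2005 for exchange noise); diffusive hydrodynamic limit
for anharmonic + conservative noise by the non-gradient method for bounded-Hessian potentials
(OllaSasada2012). The boundary-driven anharmonic statement D_N(ε) → κ_ε is NOT in print ("we are not
able to prove the same for J_s (i.e. Fourier's law)", BernardinOlla2011 p.3): the tools (ε-spectral
gap of S in the momenta, entropy-production bounds, two-block/non-gradient estimates, O(1) boundary
layers absorbed by totalCurrent = (N−1)·J̃) exist, the theorem does not. Used by the assembly only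
for ε ≤ min(ε₁,1); stated for all ε > 0 (more noise is not harder). [difficulty: XL] (why it might
fail: Even with flips, D_N(ε) → κ_ε for the boundary-driven ANHARMONIC chain is unproved (BO2011 p.3
'not able to prove'); FFL/macro-ergodicity theorems need bounded U″, V″ and the quartic pinnedChain
is outside that scope (pinnedChain_outside_FFL_scope); bath boundary layers.) [BernardinOlla2011,
BernardinOlla2005, OllaSasada2012, Bernardin2014, CuneoEckmannHairerReyBellet2018,
FritzFunakiLebowitz1994, Literature.Barriers.AtomisticToContinuum.MacroErgodicityBarrier,
Literature.Barriers.AtomisticToContinuum.pinnedChain_outside_FFL_scope]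
#9 NessUnique (support) — UNIQUENESS OF THE WEAK STEADY STATE — shared verbatim with routes
FourierGreenKubo / CurrentTiltQuench / KineticCorner (stmt-AtomisticToContinuum-0741): for
pinnedChain ω₂ lam β γ (all > 0), every N and T_L, T_R > 0, any two measures in the class
IsSteadyState coincide (CuneoEckmannHairerReyBellet2018 Thm 2.13(1) uniqueness of the invariant
measure + identification of weak stationary Fokker–Planck solutions with invariant measures,
Echeverría 1982 / Ethier–Kurtz Thm 4.9.17, non-explosion via e^{θH}). With the landed theorem
pinnedChain_exists_isSteadyState it gives clause (i); it is the hypothesis of FiniteResponseOfUnique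
and makes the deterministic response quotients of all steady families agree near δ = 0 (used in
`closes`). [difficulty: L] [CuneoEckmannHairerReyBellet2018, Carmona2007,
Literature.MathematicalPhysics.KineticTheory.HeatConduction.pinnedChain_exists_isSteadyState]
#9 FiniteResponseOfUnique (support) — FINITE-N LINEAR RESPONSE EXISTS, GIVEN UNIQUENESS — shared
verbatim with routes FourierGreenKubo / CurrentTiltQuench / KineticCorner
(stmt-AtomisticToContinuum-0717): under uniqueness of weak steady states, for every steady family, T
> 0 and N the limit D_N(T) = lim_{δ→0, δ≠0} totalCurrent(μ_{N,T+δ/2,T−δ/2})/δ exists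
(differentiability at equilibrium of NESS expectations of the polynomial currents in the bath
temperatures: HairerMajda2009 framework, ReyBellet2003 Rem 4.4 finite-volume Green–Kubo, CEHR2018
Lyapunov structure). Supplies D_N(0) to the transfer. N = 0, 1: totalCurrent ≡ 0, D = 0.
[difficulty: L] [HairerMajda2009, ReyBellet2003, CuneoEckmannHairerReyBellet2018]

TWO-LAYER PLAN. Foreseen glued splits (nothing filed now; k ≤ 3, depth 1): (a) NoiseLocality ⇐
RussoFormula (fixed N: ε ↦ D_N(ε) is C¹ on [0,1],
D_N > 0 for N ≥ 2, ∂_ε(1/D_N) = Σ_x sitewise responses, each an explicit NESS expectation against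
the linear-response density) →
SitewiseLocality (|∂(1/D_N)/∂ε_x| ≤ C(T)/(N−1) uniformly in N, x, ε) → NoiseLocality with w = Cε.
(b) VanishingNoiseBound ⇐
ExplicitModulus (NoiseLocality with an explicit w at the temperatures of interest) → OneNoiseWitness
(at one ε₀: a KLO inf-formula
test-function bound κ_{ε₀}(T) < 1/w(ε₀), Gibbs integrals certified via the 1-D transfer operator) →
NoisyFourier restricted to ε₀ →
VanishingNoiseBound. (c) NoisyFourier ⇐ NoisyNessExistsUnique (clause (i), print-level
jump-diffusion Harris theory) →
NoisyResponseConverges (clause (ii)) → NoisyFourier.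

KILL CRITERIA. Refutation of NoiseLocality for pinnedChain (a proof that 1/D_N(ε) − 1/D_N(0) is not
equicontinuous in N at 0⁺, or numerics showing
(N−1)·∂(1/D_N)/∂ε_x growing with N at T = 1) closes the route (`close --reason
refuted:NoiseLocality`): the transfer device IS the route.
Refutation of VanishingNoiseBound (κ_ε(T) → ∞ as ε ↓ 0, e.g. via a flip-non-invariant hidden
conserved quantity and Mazur, or anomalous
transport of the pinned chain) refutes, together with NoiseLocality + NoisyFourier, clause (ii) of
the conjunct itself → file ¬FouriersLaw
as a statement and close. Refutation of NoisyFourier at some ε > 0 (non-uniqueness of noisy weak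
steady states, or a flip-INVARIANT hidden
charge making κ_ε infinite) forces a pivot to another conservative noise (momentum-exchange S′ of
BernardinOlla2005 / BernardinOlla2011
Prop 5) via a repaired item, not a close. If FourierGreenKubo's GreenKubo + ThermodynamicLimit (or
any sibling route) land first, this
route is moot (`superseded`).

NOT DECOMPOSED YET. Deliberately NOT filed at open: the Russo/derivative formula, finite-N
positivity D_N(0) > 0 and the sitewise locality constant
(children of NoiseLocality, plan (a)); the explicit modulus and the one-ε₀ test-function certificate
(children of VanishingNoiseBound,
plan (b)) — they need w explicit first; the split of NoisyFourier into noisy NESS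
existence/uniqueness and response convergence (plan
(c)); any T-dependence or uniformity of w, K, ε₁ (none claimed: all constants depend on T,
consistent with the low-temperature harmonic
corner); a Literature definition of the flip-noisy chain (the statements inline it — nothing waits
on it); a Target item (X is the
conjunction of the three cruxes and two supports; a rank-0 restatement would duplicate 7 kB of terms
and carry no staffing); the
infinite-volume noisy dynamics / H₋₁ machinery that plan (b) needs (Literature infrastructure,
requested when (b) is filed).

CHEAPEST FALSIFIER. (1) Harmonic test bed (lam = β = 0, outside the conjunct but Gaussian/explicit:
in-tree HarmonicChainNESS / HarmonicChainCovariance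
Lyapunov-equation machinery at ε = 0, BernardinOlla2011 Thm 3 technique at ε > 0): compute 1/D_N(ε)
− 1/D_N(0) in closed form and
confirm it is ≤ Cε uniformly in N (expected r_N(0) = O(1/N), r_N(ε) → cε); if locality already fails
THERE the mechanism is dead.
(2) Numerics (kit; NEMD or the deterministic linear-response solve): pinnedChain(1,1,1,1), T = 1, N
∈ {16,…,256}, ε ∈ {0, 0.02, 0.05,
0.1, 0.2}: (1/D_N(ε) − 1/D_N(0)) should be N-independent to 10 % once N exceeds the flip mean free
path ~ 1/ε (IacobucciEtAl2010 warn
that small-noise asymptotics need long chains), and κ_ε should not grow as ε ↓ 0 beyond the ε = 0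
value. (3) Lookup: any printed
flip-non-invariant local conserved quantity of the quartic pinned FPU-β chain (none known; cards
integrability-sieve-dimer-accident /
no-hidden-charges-hydro-projection track this) kills VanishingNoiseBound via Mazur. Not run here (no
kit in plancard mode); what WAS run:
the deciding theorem `closes` elaborates (lean check rc 0), so the five items provably imply the
conjunct.

NUMBERS. BernardinOlla2011 Prop 4: κ_ε(T) ≤ Var_T(V′(r))/(4εT) for the flip-noisy chain (their γ =
our ε) — the O(1/ε) line OneNoiseWitness must
beat once; harmonic + flips (unpinned, V = r²/2): lim n J_s = (T_ℓ − T_r)/(4γ), i.e. κ_γ = 1/(4γ)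
exactly (BernardinOlla2011 Thm 3).
IacobucciEtAl2010: Toda + momentum-exchange noise, κ_n ~ n^α, 0 < α ≤ 1/2, α increasing with the
noise, asymptotics visible only for
n ≥ 2^12 at small noise. Low-temperature scaling of the conjunct's chain
(LowTemperatureWeakAnharmonicity): κ(T) expected
(lam T)^{−2}-large as T → 0, so w, K, ε₁ must degrade as T → 0 (no uniformity claimed). Items at
open: 6 (3 cruxes, 2 supports,
1 assembly) + `closes`.

DEFINITION REQUESTS. None filed. The flip-noisy steady-state predicate is inlined and bound once as
S in each crux (same normal form as stmt-3112/3113/3114);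
a Literature notion OscillatorChain.flipGenerator / IsFlipSteadyState (topic
Literature/MathematicalPhysics/KineticTheory, beside
FouriersLaw.lean; BernardinOlla2011 §2.1) would be a convenience for plan (b)/(c) and for vendoring
BernardinOlla2011 Thm 2 / Prop 4 /
Thm 3 as named facts, and is left to the tenure planner so that no item waits on a definition. Bib
keys added this session:
IacobucciEtAl2010 (doi:10.1007/s10955-010-9996-6), LiveraniOlla2011
(doi:10.1090/s0894-0347-2011-00724-8).

Novelty: Searches (2026-08-15, this session): `lit search --hybrid "vanishing noise limit thermal
conductivity anharmonic chain velocity flip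
uniform bound"` (12 docs, textbooks only — Gaspard 2022, Balakrishnan 2020 …, nothing on a noise → 0
transfer); `lit search --source
crossref "thermal conductivity of the Toda lattice with conservative noise"` (14:
doi:10.1007/s10955-010-9996-6 ILOS2010, read:
arXiv:0912.3416 pp. 2–3, 9); `lit search --source crossref "Fourier law anharmonic chain velocity
flip noise nonequilibrium stationary
state conductivity" --year-from 2014` (19, nearest doi:10.1088/1751-8121/aa7a30 de Oliveira 2017,
harmonic + energy-conserving noise
NESS; rest off-topic); `lit frontier AtomisticToContinuum --since 2021` (30 rows; nearest
arXiv:2310.13338 CanestrariLiveraniOlla2026,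
heat equation from a deterministic dynamics with an external chaotic bulk force — a different
regularisation, no ε → 0; arXiv:2508.15566
numerics); `lit galaxy search "energy conserving noise" --star pdf` (1: LiveraniOlla2011, weak
COUPLING limit at fixed noise) and
`"vanishing noise limit" --star pdf` (10, all SPDE/LDP, off-topic); `lit read arXiv:1105.0493` pp.
3, 13, 18 (BO2011 p.3 "not able to
prove … Fourier's law", Prop 4, Thm 3 verified); openalex / s2 rate-limited (429, logged). Plus the
card's searches and its two refuter
novelty audits (BHLLO2015, BernardinOlla2011, IacobucciEtAl2010, BasileBernardinOlla2009,
BernardinHuveneers2013, DeRoeckHuveneers2015,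
HairerMajda2009, OllaSasada201  [refs: 10.1007/s10955-010-9996-6, 10.1088/1751-8121/aa7a30, 10.1007/s00220-014-2206-7, 0912.3416, 2310.13338, 2508.15566, 1105.0493, doi:10.1007/s10955-010-9996-6, doi:10.1088/1751-8121/aa7a30, doi:10.1007/s00220-014-2206-7, CanestrariLiveraniOlla2026, LiveraniOlla2011, BernardinOlla2011, IacobucciEtAl2010, BasileBernardinOlla2009, BernardinHuveneers2013, DeRoeckHuveneers2015, HairerMajda2009, OllaSasada]

Barriers (technique_class: noise-homotopy, vanishing-noise transfer, KLO-variational): - technique_class: noise-homotopy, vanishing-noise transfer, KLO-variational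
- Literature.Barriers.AtomisticToContinuum.HasBoundedResponse: its recorded evasion (a) 'add bulk
stochasticity' is exactly X3 and the entry records that (a) 'is not the deterministic
boundary-driven chain'; X1 is the missing bridge. It does NOT make the N-uniform content disappear:
X1 is an N-uniform statement (about a LOCAL response to one scatterer, holding even in the ballistic
corner, not a mixing constant) and X1 + X2 imply HasBoundedResponse(pinnedChain); the bet is that
ε-uniform control of NOISY conductivities (variational, infinite-volume,
reversible-plus-bounded-antisymmetric structure) is more tractable than N-uniform control of the
deterministic NESS.
- Literature.Barriers.AtomisticToContinuum.MacroErgodicityBarrier: hydrodynamic/non-gradient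
machinery is invoked only inside X3 at FIXED ε > 0, where the flip Dirichlet form is non-degenerate
in all momenta (the entry's evasion (a)); the audit caveat that printed macro-ergodicity theorems
need bounded U″, V″ (theorem pinnedChain_outside_FFL_scope of MacroErgodicityHypothesis.lean,
proved) is carried as NoisyFourier's why-might-fail; at ε = 0 nothing hydrodynamic is used.
- Literature.Barriers.AtomisticToContinuum.BeckerMenegaki2022_gapClosing: no N-uniform relaxation
rate of the deterministic or boundary-damped chain is used anywhere; fixed-N smoothness in ε (plan
(a)) needs no uniformity, and the N-uniform object is a resistivity incremen

Novelty grade: new-combination — ROUTE REVIEW (refuter refuter-rreview-0815T18-15-0, 2026-08-15T19:35Z). VERDICT: KEEP OPEN — precise, non-vacuous, grounded, not refuted; two layers sensible (6 items: 3 cruxes + 2 shared supports + assembly; `closes` proved in-file, gate native-OK, re-read: the transfer lemma is correct and exchang (refuter refuter-rreview-0815T18-15-0, 2026-08-15T19:40:34Z; prior: BernardinOlla2011 arXiv:1105.0493 (flip-noisy chain: Green–Kubo exists, Prop 4 O(1/ε) bound, Thm 3 harmonic Fourier), BernardinHuveneersLebowitzLiveraniOlla2015 doi:10.1007/s00220-014-2206-7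 §1 (vanishing-noise question posed, formal expansions only), IacobucciEtAl2010 doi:10.1007/s10955-010-9996-6 (Toda/FPU + conservative noise numerics), HairerMajda2009 arXiv:0909.4313 (finite-N linear response )

History (route lifecycle, newest last):
- 2026-08-24T01:20:31Z · DORMANT — reconciler: no traction for 6.4 d (last activity item-evidence-added at 2026-08-17T14:55:26Z); parked, not closed — `ledger route dormant route-AtomisticToConti (operator:999:1308081)

sub-problem: FouriersLaw · status: dormant · opened planner-plancard-AtomisticToContinuum-Fourier-11dc88bb-g2-0 2026-08-15T18:47:09Z · rev 3 · ledger route-AtomisticToContinuum-VanishingNoiseTransfer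
GENERATED by the gate from the ledger (D-0016/17). Provers cite these decls: `theorem foo : Summit.AtomisticToContinuum.FouriersLaw.Theses.VanishingNoiseTransfer.<Decl> := …` in Summits/AtomisticToContinuum/FouriersLaw/Theorems/<Name>.lean.
-/

namespace Summit.AtomisticToContinuum.FouriersLaw.Theses.VanishingNoiseTransfer

open scoped BigOperators Topology Manifold Classical MeasureTheory ProbabilityTheory Matrix InnerProductSpace ComplexConjugate ContinuousMap
open Filter Set Function TopologicalSpace MeasureTheory

attribute [summit_statement] _root_.FouriersLaw

/-- item stmt-AtomisticToContinuum-11975 · crux · rank 2 · open · by planner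
why it might fail: N-uniform equicontinuity at ε = 0⁺ carries the 'limit exists' half of Fourier's law: false if D_N(0) oscillates in N while each D_N(ε) converges; the sitewise response is a space-time NESS correlation with no N-uniform bound in print (breathers, low-T near-integrable phonons).
sources: BernardinOlla2011, BernardinHuveneersLebowitzLiveraniOlla2015, HairerMajda2009, BernardinHuveneers2013, IacobucciEtAl2010, Spohn2014
[crux] NOISE LOCALITY (card item 2, modulus form; verbatim re-filing of
stmt-AtomisticToContinuum-3112). Noisy chain := pinnedChain ω₂ lam β γ between the same Langevin
baths PLUS independent velocity flips p_i ↦ −p_i at every site at rate ε (generator L + εS,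
BernardinOlla2011 §2.1); weak noisy steady state := probability measure with ∫ (L f + ε S f) dμ = 0
for f ∈ C_c^∞ and integrable bond currents (flips carry no energy current, so
bondCurrent/totalCurrent are the deterministic functionals; at ε = 0 this is IsSteadyState
verbatim); the predicate is bound once as S with a defining equation. CLAIM: for all parameters > 0
and T > 0 there is a modulus w, w(ε) → 0 as ε ↓ 0, UNIFORM IN N, such that for every N, every ε ∈
(0,1], the unique deterministic steady family μ⁰ and the unique noisy family μ^ε at this N and their
response coefficients D⁰, D^ε at T: |D⁰ − D^ε| ≤ w(ε)·|D⁰|·|D^ε| (division-free |1/D_N(ε) −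
1/D_N(0)| ≤ w(ε); it forces D_N(0) ≠ 0 wherever D_N(ε) ≠ 0 — the prover supplies D_N(0) ≠ 0 for N ≥
2 — and one takes w ≥ 0). Expected proof output w = C(T)ε from a Russo-type derivative formula
∂_ε(1/D_N) = Σ_x ∂(1/D_N)/∂ε_x with the sitewise bound |∂(1/D_N)/∂ε_x| ≤ C/(N−1); a -/
@[route_item "route-AtomisticToContinuum-VanishingNoiseTransfer", crux]
def NoiseLocality : Prop :=
  ∀ ω₂ lam β γ : ℝ, 0 < ω₂ → 0 < lam → 0 < β → 0 < γ → ∀ S : ℝ → (N : ℕ) → ℝ → ℝ → MeasureTheory.Measure (Literature.MathematicalPhysics.KineticTheory.HeatConduction.PhaseSpace N) → Prop, S = (fun (ε : ℝ) (N : ℕ) (T_L T_R : ℝ) (μ : MeasureTheory.Measure (Literature.MathematicalPhysics.KineticTheory.HeatConduction.PhaseSpace N)) => MeasureTheory.IsProbabilityMeasure μ ∧ (∀ f : Literature.MathematicalPhysics.KineticTheory.HeatConduction.PhaseSpace N → ℝ, ContDiff ℝ ((⊤ : ℕ∞) : WithTop ℕ∞) f → HasCompactSupport f → MeasureTheory.integral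 μ (fun x => (Literature.MathematicalPhysics.KineticTheory.HeatConduction.pinnedChain ω₂ lam β γ).generator N T_L T_R f x + ε * ∑ i : Fin N, (f (x.1, Function.update x.2 i (-x.2 i)) - f x)) = 0) ∧ ∀ i : Fin N, MeasureTheory.Integrable ((Literature.MathematicalPhysics.KineticTheory.HeatConduction.pinnedChain ω₂ lam β γ).bondCurrent N i) μ) → ∀ T : ℝ, 0 < T → ∃ w : ℝ → ℝ, Filter.Tendsto w (nhdsWithin 0 (Set.Ioi 0)) (nhds 0) ∧ ∀ (N : ℕ) (ε : ℝ), 0 < ε → ε ≤ 1 → ∀ μ0 με : ℝ → ℝ → MeasureTheory.Measure (Literature.MathematicalPhysics.KineticTheory.HeatConduction.PhaseSpace N), (∀ T_L T_R : ℝ, 0 < T_L → 0 < T_R → (Literature.MathematicalPhysics.KineticTheory.HeatConduction.pinnedChain ω₂ lam β γ).IsSteadyState N T_L T_R (μ0 T_L T_R) ∧ ∀ ν : MeasureTheory.Measure (Literature.MathematicalPhysics.KineticTheory.HeatConduction.PhaseSpace N), (Literature.MathematicalPhysics.KineticTheory.HeatConduction.pinnedChain ω₂ lam β γ).IsSteadyState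 N T_L T_R ν → ν = μ0 T_L T_R) → (∀ T_L T_R : ℝ, 0 < T_L → 0 < T_R → S ε N T_L T_R (με T_L T_R) ∧ ∀ ν : MeasureTheory.Measure (Literature.MathematicalPhysics.KineticTheory.HeatConduction.PhaseSpace N), S ε N T_L T_R ν → ν = με T_L T_R) → ∀ D0 Dε : ℝ, Filter.Tendsto (fun δ : ℝ => (Literature.MathematicalPhysics.KineticTheory.HeatConduction.pinnedChain ω₂ lam β γ).totalCurrent (μ0 (T + δ / 2) (T - δ / 2)) / δ) (nhdsWithin 0 {(0 : ℝ)}ᶜ) (nhds D0) → Filter.Tendsto (fun δ : ℝ => (Literature.MathematicalPhysics.KineticTheory.HeatConduction.pinnedChain ω₂ lam β γ).totalCurrent (με (T + δ / 2) (T - δ / 2)) / δ) (nhdsWithin 0 {(0 : ℝ)}ᶜ) (nhds Dε) → |D0 - Dε| ≤ w ε * |D0| * |Dε|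

/-- item stmt-AtomisticToContinuum-11976 · crux · rank 3 · open · by planner
why it might fail: ε-uniform control of noise-regularised conductivities as noise → 0 is BHLLO2015's open question; every printed variational bound is O(1/ε) (BO2011 Prop 4); beating 1/ε needs an approximate deterministic corrector, possibly GreenKubo-hard; noise may even suppress nonlinear scattering (ILOS2010).
sources: BernardinOlla2011, BernardinHuveneersLebowitzLiveraniOlla2015, Bernardin2014, KipnisLandim1999, IacobucciEtAl2010, BonettoLebowitzReyBellet2000
[crux] VANISHING-NOISE BOUND (card item 4 'StrictNoisyBound' in closed form; verbatim re-filing of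
stmt-AtomisticToContinuum-3113; S = the flip-noisy steady-state predicate of NoiseLocality). CLAIM:
for all parameters > 0 and T > 0 there are K and ε₁ > 0 such that for every ε ∈ (0, ε₁], the unique
noisy steady family at rate ε, every sequence D_N(ε) of its response coefficients at T and every
limit k = lim_N D_N(ε): k ≤ K — the noisy conductivities κ_ε(T) stay bounded as the noise vanishes.
This is where κ(0) < ∞ lives: given NoiseLocality (modulus w) and NoisyFourier, |r₀ − 1/κ_ε| ≤ w(ε),
so the item ⇔ r₀ > 0 ⇔ there is ONE ε₀ ∈ (0,1] with 1/κ_{ε₀}(T) > w(ε₀). Operational form once w is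
explicit (foreseen split): certify κ_{ε₀}(T) < 1/w(ε₀) by the Kipnis–Landim–Olla / Sethuraman
inf-variational formula for the NOISY infinite chain, whose symmetric part εS is a bounded Dirichlet
form non-degenerate in the momenta (BernardinOlla2011 eq. (var); their Prop 4 with f = −V(r₁)/2
gives only κ_ε(T) ≤ Var(V′)/(4εT), i.e. ON the harmonic line c/ε — one must beat 1/ε once with a
test function encoding anharmonic scattering; the Gibbs integrals are 1-D transfer-operator
quantities). Fails, as -/
@[route_item "route-AtomisticToContinuum-VanishingNoiseTransfer", crux]
def VanishingNoiseBound : Prop :=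
  ∀ ω₂ lam β γ : ℝ, 0 < ω₂ → 0 < lam → 0 < β → 0 < γ → ∀ S : ℝ → (N : ℕ) → ℝ → ℝ → MeasureTheory.Measure (Literature.MathematicalPhysics.KineticTheory.HeatConduction.PhaseSpace N) → Prop, S = (fun (ε : ℝ) (N : ℕ) (T_L T_R : ℝ) (μ : MeasureTheory.Measure (Literature.MathematicalPhysics.KineticTheory.HeatConduction.PhaseSpace N)) => MeasureTheory.IsProbabilityMeasure μ ∧ (∀ f : Literature.MathematicalPhysics.KineticTheory.HeatConduction.PhaseSpace N → ℝ, ContDiff ℝ ((⊤ : ℕ∞) : WithTop ℕ∞) f → HasCompactSupport f → MeasureTheory.integral μ (fun x => (Literature.MathematicalPhysics.KineticTheory.HeatConduction.pinnedChain ω₂ lam β γ).generator N T_L T_R f x + ε * ∑ i : Fin N, (f (x.1, Function.update x.2 i (-x.2 i)) - f x)) = 0) ∧ ∀ i : Fin N, MeasureTheory.Integrable ((Literature.MathematicalPhysics.KineticTheory.HeatConduction.pinnedChain ω₂ lam β γ).bondCurrent N i) μ) → ∀ T : ℝ, 0 < T → ∃ K ε₁ : ℝ, 0 < ε₁ ∧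 ∀ ε : ℝ, 0 < ε → ε ≤ ε₁ → ∀ μ : (N : ℕ) → ℝ → ℝ → MeasureTheory.Measure (Literature.MathematicalPhysics.KineticTheory.HeatConduction.PhaseSpace N), (∀ (N : ℕ) (T_L T_R : ℝ), 0 < T_L → 0 < T_R → S ε N T_L T_R (μ N T_L T_R) ∧ ∀ ν : MeasureTheory.Measure (Literature.MathematicalPhysics.KineticTheory.HeatConduction.PhaseSpace N), S ε N T_L T_R ν → ν = μ N T_L T_R) → ∀ (D : ℕ → ℝ) (k : ℝ), (∀ N : ℕ, Filter.Tendsto (fun δ : ℝ => (Literature.MathematicalPhysics.KineticTheory.HeatConduction.pinnedChain ω₂ lam β γ).totalCurrent (μ N (T + δ / 2) (T - δ / 2)) / δ) (nhdsWithin 0 {(0 : ℝ)}ᶜ) (nhds (D N))) → Filter.Tendsto D Filter.atTop (nhds k) → k ≤ K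

/-- item stmt-AtomisticToContinuum-11977 · crux · rank 4 · open · by planner
why it might fail: Even with flips, D_N(ε) → κ_ε for the boundary-driven ANHARMONIC chain is unproved (BO2011 p.3 'not able to prove'); FFL/macro-ergodicity theorems need bounded U″, V″ and the quartic pinnedChain is outside that scope (pinnedChain_outside_FFL_scope); bath boundary layers.
sources: BernardinOlla2011, BernardinOlla2005, OllaSasada2012, Bernardin2014, CuneoEckmannHairerReyBellet2018, FritzFunakiLebowitz1994
[crux] NOISY FOURIER LAW (card item 3; verbatim re-filing of stmt-AtomisticToContinuum-3114; S as
above). CLAIM: for all parameters > 0 and EVERY flip rate ε > 0, OscillatorChain.FouriersLawFor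
verbatim for the noisy chain: (i) for all N and T_L, T_R > 0 the weak steady state of L + εS exists
and is unique; (ii) there is κ_ε : ℝ → ℝ with κ_ε(T) > 0 for T > 0 such that for every noisy steady
family and every T > 0 the response limits D_N(ε) = lim_{δ→0, δ≠0} totalCurrent(μ_{N,T+δ/2,T−δ/2})/δ
exist for all N and D_N(ε) → κ_ε(T). Print: NESS existence/uniqueness for anharmonic chain + flips +
Langevin baths (BernardinOlla2011 Prop 1, unpinned with tension; pinned:
CuneoEckmannHairerReyBellet2018 Lyapunov/Harris machinery + bounded jump perturbation +
Echeverría-type identification of weak solutions of the jump-diffusion Fokker–Planck equation);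
Green–Kubo limit exists with flips (BernardinOlla2011 Thm 2) with two-sided bounds (Props 4–8);
Fourier's law IN THE NESS only for the harmonic bulk (BernardinOlla2011 Thm 3: lim n J_s = (T_ℓ −
T_r)/(4γ); BernardinOlla2005 for exchange noise); diffusive hydrodynamic limit for anharmonic +
conservative noise by the non-gradient method for bounded -/
@[route_item "route-AtomisticToContinuum-VanishingNoiseTransfer", crux]
def NoisyFourier : Prop :=
  ∀ ω₂ lam β γ : ℝ, 0 < ω₂ → 0 < lam → 0 < β → 0 < γ → ∀ S : ℝ → (N : ℕ) → ℝ → ℝ → MeasureTheory.Measure (Literature.MathematicalPhysics.KineticTheory.HeatConduction.PhaseSpace N) → Prop, S = (fun (ε : ℝ) (N : ℕ) (T_L T_R : ℝ) (μ : MeasureTheory.Measure (Literature.MathematicalPhysics.KineticTheory.HeatConduction.PhaseSpace N)) => MeasureTheory.IsProbabilityMeasure μ ∧ (∀ f : Literature.MathematicalPhysics.KineticTheory.HeatConduction.PhaseSpace N → ℝ, ContDiff ℝ ((⊤ : ℕ∞) : WithTop ℕ∞) f → HasCompactSupport f → MeasureTheory.integral μ (fun x => (Literature.MathematicalPhysics.KineticTheory.HeatConduction.pinnedChain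 ω₂ lam β γ).generator N T_L T_R f x + ε * ∑ i : Fin N, (f (x.1, Function.update x.2 i (-x.2 i)) - f x)) = 0) ∧ ∀ i : Fin N, MeasureTheory.Integrable ((Literature.MathematicalPhysics.KineticTheory.HeatConduction.pinnedChain ω₂ lam β γ).bondCurrent N i) μ) → ∀ ε : ℝ, 0 < ε → (∀ (N : ℕ) (T_L T_R : ℝ), 0 < T_L → 0 < T_R → ∃ μ : MeasureTheory.Measure (Literature.MathematicalPhysics.KineticTheory.HeatConduction.PhaseSpace N), S ε N T_L T_R μ ∧ ∀ ν : MeasureTheory.Measure (Literature.MathematicalPhysics.KineticTheory.HeatConduction.PhaseSpace N), S ε N T_L T_R ν → ν = μ) ∧ ∃ κ : ℝ → ℝ, (∀ T : ℝ, 0 < T → 0 < κ T) ∧ ∀ μ : (N : ℕ) → ℝ → ℝ → MeasureTheory.Measure (Literature.MathematicalPhysics.KineticTheory.HeatConduction.PhaseSpace N), (∀ (N : ℕ) (T_L T_R : ℝ), 0 < T_L → 0 < T_R → S ε N T_L T_R (μ N T_L T_R)) → ∀ T : ℝ, 0 < T → ∃ D : ℕ → ℝ, (∀ N : ℕ, Filter.Tendsto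 (fun δ : ℝ => (Literature.MathematicalPhysics.KineticTheory.HeatConduction.pinnedChain ω₂ lam β γ).totalCurrent (μ N (T + δ / 2) (T - δ / 2)) / δ) (nhdsWithin 0 {(0 : ℝ)}ᶜ) (nhds (D N))) ∧ Filter.Tendsto D Filter.atTop (nhds (κ T))

/-- item stmt-AtomisticToContinuum-0717 · support · rank 9 · closed · proved by Summit.AtomisticToContinuum.FouriersLaw.Theorems.FourierGreenKubo.finiteResponseOfUnique_holds (prover) · by planner
CONDITIONAL FORM OF 0705 (supersedes it as the prover target; refuters pool-5/g3-0: 0705 stand-alone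
quantifies over EVERY steady-state family and is false-prone if weak steady states were non-unique):
assuming UNIQUENESS of weak steady states (IsSteadyState class) for pinnedChain at all N, T_L, T_R >
0, the finite-N linear-response limit D_N(T) = lim_{δ→0, δ≠0} totalCurrent(μ_{N,T+δ/2,T−δ/2})/δ
exists for every T > 0 and N. Content: differentiability at equilibrium of NESS expectations of the
polynomial currents in the bath temperatures (ReyBellet2003 arXiv:math-ph/0303021 Rem 4.4 (51)–(56)
finite-volume Green–Kubo; HairerMajda2009 arXiv:0909.4313 Thm 2.3 framework — their SDE Thm 4.4
Assumption 5 fails here, so verify Assumptions 1–3 via CEHR2018 (2.5)/Carmona2007 Thm 1.1(iv)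
weighted spectral gap). N = 0, 1: totalCurrent ≡ 0, D = 0. Together with 0706 gives 0705. -/
@[route_item "route-AtomisticToContinuum-VanishingNoiseTransfer", crux]
def FiniteResponseOfUnique : Prop :=
  ∀ ω₂ lam β γ : ℝ, 0 < ω₂ → 0 < lam → 0 < β → 0 < γ → (∀ (N : ℕ) (T_L T_R : ℝ), 0 < T_L → 0 < T_R → ∀ μ ν : MeasureTheory.Measure (Literature.MathematicalPhysics.KineticTheory.HeatConduction.PhaseSpace N), (Literature.MathematicalPhysics.KineticTheory.HeatConduction.pinnedChain ω₂ lam β γ).IsSteadyState N T_L T_R μ → (Literature.MathematicalPhysics.KineticTheory.HeatConduction.pinnedChain ω₂ lam β γ).IsSteadyState N T_L T_R ν → μ = ν) → ∀ μ : (N : ℕ) → ℝ → ℝ → MeasureTheory.Measure (Literature.MathematicalPhysics.KineticTheory.HeatConduction.PhaseSpace N), (∀ (N : ℕ) (T_L T_R : ℝ), 0 < T_L → 0 < T_R → (Literature.MathematicalPhysics.KineticTheory.HeatConduction.pinnedChain ω₂ lam β γ).IsSteadyState N T_L T_R (μ N T_L T_R)) → ∀ T : ℝ, 0 < T → ∀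 N : ℕ, ∃ D : ℝ, Filter.Tendsto (fun δ : ℝ => (Literature.MathematicalPhysics.KineticTheory.HeatConduction.pinnedChain ω₂ lam β γ).totalCurrent (μ N (T + δ / 2) (T - δ / 2)) / δ) (nhdsWithin 0 {(0 : ℝ)}ᶜ) (nhds D)

/-- `FiniteResponseOfUnique` holds: proved by `Summit.AtomisticToContinuum.FouriersLaw.Theorems.FourierGreenKubo.finiteResponseOfUnique_holds`. -/
theorem FiniteResponseOfUnique_holds : FiniteResponseOfUnique := _root_.Summit.AtomisticToContinuum.FouriersLaw.Theorems.FourierGreenKubo.finiteResponseOfUnique_holds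

/-- item stmt-AtomisticToContinuum-0741 · support · rank 9 · closed · proved by Summit.AtomisticToContinuum.FouriersLaw.Theorems.nessUnique_proof (prover) · by planner
[crux] UNIQUENESS OF THE WEAK STEADY STATE (the half of stmt-0706 not covered by the landed fact
Literature.MathematicalPhysics.KineticTheory.HeatConduction.CuneoEckmannHairerReyBellet2018_pinnedChain,
p3544): for pinnedChain ω₂ lam β γ (all > 0), every N and T_L, T_R > 0, any two measures in the weak
Fokker–Planck class IsSteadyState (probability, ∫ L f dμ = 0 for f ∈ C_c^∞, bond currents
integrable) coincide. Print: uniqueness of the INVARIANT MEASURE of the Langevin semigroup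
(CuneoEckmannHairerReyBellet2018 Thm 2.13(1): C1, C2, CA; Carmona2007 Thm 1.1(iii)); the item
additionally needs 'weak stationary probability solution of L*μ = 0 ⇒ P_t-invariant' for this
hypoelliptic L with cubic drift (Echeverría 1982 well-posed martingale problem on C_c^∞ +
non-explosion via e^{θH}; Bogachev–Krylov–Röckner–Shaposhnikov 2015 Ch. 5 is non-degenerate only) —
the FP-identification lemma is the formal crux. N = 0: PhaseSpace 0 is a point (unique probability
measure); N = 1: both baths on site 0, OU at temperature (T_L+T_R)/2. This is exactly the hypothesis
of FiniteResponse and ThermodynamicLimit and, with the fact, gives clause (i) of FouriersLawFor. -/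
@[route_item "route-AtomisticToContinuum-VanishingNoiseTransfer", crux]
def NessUnique : Prop :=
  ∀ ω₂ lam β γ : ℝ, 0 < ω₂ → 0 < lam → 0 < β → 0 < γ → ∀ (N : ℕ) (T_L T_R : ℝ), 0 < T_L → 0 < T_R → ∀ μ ν : MeasureTheory.Measure (Literature.MathematicalPhysics.KineticTheory.HeatConduction.PhaseSpace N), (Literature.MathematicalPhysics.KineticTheory.HeatConduction.pinnedChain ω₂ lam β γ).IsSteadyState N T_L T_R μ → (Literature.MathematicalPhysics.KineticTheory.HeatConduction.pinnedChain ω₂ lam β γ).IsSteadyState N T_L T_R ν → μ = ν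

/-- `NessUnique` holds: proved by `Summit.AtomisticToContinuum.FouriersLaw.Theorems.nessUnique_proof`. -/
theorem NessUnique_holds : NessUnique := _root_.Summit.AtomisticToContinuum.FouriersLaw.Theorems.nessUnique_proof

-- TODO item stmt-AtomisticToContinuum-11978 · assembly · rank 1 · open · by planner — BLOCKED: missing decl(s) FiniteResponseOfUnique, NessUnique; restate via `ledger route edit` once they land:
--   def Assembly : Prop := NoiseLocality → VanishingNoiseBound → NoisyFourier → NessUnique → FiniteResponseOfUnique → _root_.FouriersLaw

/-! D-0027 §2.1 — DECIDING THEOREM (planner-authored via `route open/edit --closes-file`; by planner-rbadge-AtomisticToContinuum-VanishingN-afbdd651-0 2026-08-15T20:32:14Z):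
its hypotheses are this route's items and its conclusion the sub-problem Statement (glue_lint), and it elaborates with this file. -/

@[closes "route-AtomisticToContinuum-VanishingNoiseTransfer"] theorem closes (hNL : NoiseLocality) (hVB : VanishingNoiseBound) (hNF : NoisyFourier)
    (hNU : NessUnique) (hFR : FiniteResponseOfUnique) : _root_.FouriersLaw := by
  -- (0) VANISHING-NOISE TRANSFER, pure real analysis
  have transfer : ∀ (D0 : ℕ → ℝ) (w : ℝ → ℝ), Filter.Tendsto w (nhdsWithin 0 (Set.Ioi 0)) (nhds 0) →
      ∀ (ε₁ K : ℝ), 0 < ε₁ →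
      (∀ ε : ℝ, 0 < ε → ε ≤ ε₁ → ∃ kε : ℝ, ∃ Dε : ℕ → ℝ, 0 < kε ∧ kε ≤ K ∧
        Filter.Tendsto Dε Filter.atTop (nhds kε) ∧ ∀ N, |D0 N - Dε N| ≤ w ε * |D0 N| * |Dε N|) →
      ∃ L : ℝ, 0 < L ∧ Filter.Tendsto D0 Filter.atTop (nhds L) := by
    intro D0 w hw ε₁ K hε₁ h
    have hK : 0 < K := by
      obtain ⟨kε, Dε, hk, hkK, -, -⟩ := h ε₁ hε₁ le_rfl
      exact hk.trans_le hkK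
    -- for admissible ε: eventually |(D0 N)⁻¹ - kε⁻¹| < |w ε| + η
    have key : ∀ ε : ℝ, 0 < ε → ε ≤ ε₁ → ∃ kε : ℝ, 0 < kε ∧ kε ≤ K ∧
        ∀ η : ℝ, 0 < η → ∀ᶠ N in Filter.atTop, |(D0 N)⁻¹ - kε⁻¹| < |w ε| + η := by
      intro ε hε hε'
      obtain ⟨kε, Dε, hk, hkK, hconv, hloc⟩ := h ε hε hε'
      refine ⟨kε, hk, hkK, fun η hη => ?_⟩
      have hinv : Filter.Tendsto (fun N => (Dε N)⁻¹) Filter.atTop (nhds kε⁻¹) := hconv.inv₀ hk.ne'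
      have h1 : ∀ᶠ N in Filter.atTop, kε / 2 < Dε N := hconv.eventually_const_lt (by linarith)
      have h2 : ∀ᶠ N in Filter.atTop, |(Dε N)⁻¹ - kε⁻¹| < η := by
        have := (Metric.tendsto_nhds.mp hinv) η hη
        simpa only [Real.dist_eq] using this
      filter_upwards [h1, h2] with N hN1 hN2
      have hDpos : 0 < Dε N := by linarith
      have hloc' := hloc N
      have hD0 : D0 N ≠ 0 := by
        intro h0
        rw [h0] at hloc'
        simp only [zero_sub, abs_neg, abs_zero, mul_zero, zero_mul] at hloc'
        exact absurd (abs_nonpos_iff.mp hloc') hDpos.ne'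
      have h3 : |(D0 N)⁻¹ - (Dε N)⁻¹| ≤ |w ε| := by
        have hprod : 0 < |D0 N| * |Dε N| := mul_pos (abs_pos.mpr hD0) (abs_pos.mpr hDpos.ne')
        have heq : (D0 N)⁻¹ - (Dε N)⁻¹ = (Dε N - D0 N) / (D0 N * Dε N) := by
          field_simp
        rw [heq, abs_div, abs_mul, div_le_iff₀ hprod]
        calc |Dε N - D0 N| = |D0 N - Dε N| := abs_sub_comm _ _
          _ ≤ w ε * |D0 N| * |Dε N| := hloc'
          _ ≤ |w ε| * |D0 N| * |Dε N| := by gcongr; exact le_abs_self _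
          _ = |w ε| * (|D0 N| * |Dε N|) := by ring
      calc |(D0 N)⁻¹ - kε⁻¹| ≤ |(D0 N)⁻¹ - (Dε N)⁻¹| + |(Dε N)⁻¹ - kε⁻¹| := abs_sub_le _ _ _
        _ < |w ε| + η := by linarith
    -- admissible ε with small modulus exist
    have hsmall : ∀ η : ℝ, 0 < η → ∃ ε : ℝ, 0 < ε ∧ ε ≤ ε₁ ∧ |w ε| < η := by
      intro η hη
      have h1 : ∀ᶠ ε in nhdsWithin (0 : ℝ) (Set.Ioi 0), |w ε| < η := by
        have := (Metric.tendsto_nhds.mp hw) η hη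
        simpa only [Real.dist_eq, sub_zero] using this
      have h2 : ∀ᶠ ε in nhdsWithin (0 : ℝ) (Set.Ioi 0), ε ≤ ε₁ :=
        mem_nhdsWithin_of_mem_nhds (Iic_mem_nhds hε₁)
      have h3 : ∀ᶠ ε in nhdsWithin (0 : ℝ) (Set.Ioi 0), 0 < ε := self_mem_nhdsWithin
      obtain ⟨ε, hε, hε1, hε2⟩ := (h3.and (h2.and h1)).exists
      exact ⟨ε, hε, hε1, hε2⟩
    -- the resistivities r N = (D0 N)⁻¹ form a Cauchy sequence
    have hcauchy : CauchySeq (fun N => (D0 N)⁻¹) := by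
      refine Metric.cauchySeq_iff.2 fun η hη => ?_
      obtain ⟨ε, hε, hε', hwε⟩ := hsmall (η / 4) (by positivity)
      obtain ⟨kε, hk, hkK, hev⟩ := key ε hε hε'
      obtain ⟨N₀, hN₀⟩ := (hev (η / 4) (by positivity)).exists_forall_of_atTop
      refine ⟨N₀, fun m hm n hn => ?_⟩
      have hm' := hN₀ m hm
      have hn' := hN₀ n hn
      rw [Real.dist_eq]
      calc |(D0 m)⁻¹ - (D0 n)⁻¹| ≤ |(D0 m)⁻¹ - kε⁻¹| + |kε⁻¹ - (D0 n)⁻¹| := abs_sub_le _ _ _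
        _ = |(D0 m)⁻¹ - kε⁻¹| + |(D0 n)⁻¹ - kε⁻¹| := by rw [abs_sub_comm kε⁻¹ (D0 n)⁻¹]
        _ < η := by linarith
    obtain ⟨r₀, hr₀⟩ := cauchySeq_tendsto_of_complete hcauchy
    -- its limit r₀ is at least 1/K > 0
    have hlow : ∀ η : ℝ, 0 < η → K⁻¹ - η ≤ r₀ := by
      intro η hη
      obtain ⟨ε, hε, hε', hwε⟩ := hsmall (η / 2) (by positivity)
      obtain ⟨kε, hk, hkK, hev⟩ := key ε hε hε'
      have hkinv : K⁻¹ ≤ kε⁻¹ := inv_anti₀ hk hkK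
      have hevr : ∀ᶠ N in Filter.atTop, K⁻¹ - η ≤ (D0 N)⁻¹ := by
        filter_upwards [hev (η / 2) (by positivity)] with N hN
        have := (abs_lt.mp hN).1
        linarith
      exact ge_of_tendsto hr₀ hevr
    have hr₀pos : 0 < r₀ := by
      have h1 := hlow (K⁻¹ / 2) (by positivity)
      have hKinv : 0 < K⁻¹ := inv_pos.mpr hK
      linarith
    refine ⟨r₀⁻¹, inv_pos.mpr hr₀pos, ?_⟩
    have hD : D0 = fun N => ((D0 N)⁻¹)⁻¹ := by
      funext N
      simp
    rw [hD]
    exact hr₀.inv₀ hr₀pos.ne'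
  -- a family of measures chosen at positive temperatures
  have famChoice : ∀ {Q : (N : ℕ) → ℝ → ℝ →
      MeasureTheory.Measure (Literature.MathematicalPhysics.KineticTheory.HeatConduction.PhaseSpace N) → Prop},
      (∀ (N : ℕ) (T_L T_R : ℝ), 0 < T_L → 0 < T_R → ∃ μ, Q N T_L T_R μ) →
      ∃ fam : (N : ℕ) → ℝ → ℝ →
          MeasureTheory.Measure (Literature.MathematicalPhysics.KineticTheory.HeatConduction.PhaseSpace N),
        ∀ (N : ℕ) (T_L T_R : ℝ), 0 < T_L → 0 < T_R → Q N T_L T_R (fam N T_L T_R) := by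
    intro Q hQ
    classical
    refine ⟨fun N T_L T_R => if h : 0 < T_L ∧ 0 < T_R then (hQ N T_L T_R h.1 h.2).choose else 0,
      fun N T_L T_R hL hR => ?_⟩
    simp only [dif_pos (And.intro hL hR)]
    exact (hQ N T_L T_R hL hR).choose_spec
  -- (1) unfold the conjunct: FouriersLaw = ∀ parameters > 0, FouriersLawFor (pinnedChain …)
  intro ω₂ lam β γ hω hl hβ hγ
  have huniq := hNU ω₂ lam β γ hω hl hβ hγ
  -- reference steady-state family (landed existence theorem; unique by NessUnique)
  obtain ⟨μ0, hμ0⟩ := famChoice (fun N T_L T_R hL hR =>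
    Literature.MathematicalPhysics.KineticTheory.HeatConduction.pinnedChain_exists_isSteadyState
      hω hl hβ hγ N hL hR)
  refine ⟨?_, ?_⟩
  · -- clause (i): existence + uniqueness of the steady state
    intro N T_L T_R hL hR
    exact ⟨μ0 N T_L T_R, hμ0 N T_L T_R hL hR, fun ν hν => huniq N T_L T_R hL hR ν _ hν (hμ0 N T_L T_R hL hR)⟩
  · -- clause (ii)
    -- deterministic finite-N responses of the reference family (item FiniteResponseOfUnique)
    have hD0ex : ∀ T : ℝ, 0 < T → ∀ N : ℕ, ∃ D : ℝ, Filter.Tendsto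
        (fun δ : ℝ => (Literature.MathematicalPhysics.KineticTheory.HeatConduction.pinnedChain ω₂ lam β γ).totalCurrent
          (μ0 N (T + δ / 2) (T - δ / 2)) / δ) (nhdsWithin 0 {(0 : ℝ)}ᶜ) (nhds D) :=
      fun T hT => hFR ω₂ lam β γ hω hl hβ hγ huniq μ0 hμ0 T hT
    -- main step: D_N(0) → L(T) ∈ (0, ∞), by the transfer fed with the three cruxes
    have hmain : ∀ (T : ℝ) (hT : 0 < T), ∃ L : ℝ, 0 < L ∧
        Filter.Tendsto (fun N => (hD0ex T hT N).choose) Filter.atTop (nhds L) := by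
      intro T hT
      have hD0 := fun N => (hD0ex T hT N).choose_spec
      obtain ⟨w, hw, hloc⟩ := hNL ω₂ lam β γ hω hl hβ hγ _ rfl T hT
      obtain ⟨K, ε₁, hε₁, hbound⟩ := hVB ω₂ lam β γ hω hl hβ hγ _ rfl T hT
      refine transfer _ w hw (min ε₁ 1) K (lt_min hε₁ one_pos) fun ε hε hεle => ?_
      have hεle₁ : ε ≤ ε₁ := hεle.trans (min_le_left _ _)
      have hεle1 : ε ≤ 1 := hεle.trans (min_le_right _ _)
      obtain ⟨hexu, κε, hκεpos, hresp⟩ := hNF ω₂ lam β γ hω hl hβ hγ _ rfl ε hε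
      -- the unique noisy steady-state family at rate ε (NoisyFourier clause (i))
      obtain ⟨με, hμε⟩ := famChoice hexu
      -- its responses and their limit κ_ε(T) (NoisyFourier clause (ii))
      obtain ⟨Dε, hDε, hDεlim⟩ := hresp με (fun N T_L T_R hL hR => (hμε N T_L T_R hL hR).1) T hT
      refine ⟨κε T, Dε, hκεpos T hT, ?_, hDεlim, fun N => ?_⟩
      · -- κ_ε(T) ≤ K (VanishingNoiseBound)
        exact hbound ε hε hεle₁ με hμε Dε (κε T) hDε hDεlim
      · -- |D_N(0) - D_N(ε)| ≤ w ε |D_N(0)| |D_N(ε)| (NoiseLocality at length N)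
        exact hloc N ε hε hεle1 (μ0 N) (με N)
          (fun T_L T_R hL hR => ⟨hμ0 N T_L T_R hL hR,
            fun ν hν => huniq N T_L T_R hL hR ν _ hν (hμ0 N T_L T_R hL hR)⟩)
          (fun T_L T_R hL hR => hμε N T_L T_R hL hR) _ _ (hD0 N) (hDε N)
    -- the conductivity
    refine ⟨fun T => if hT : 0 < T then (hmain T hT).choose else 1, fun T hT => ?_, fun μ hμ T hT => ?_⟩
    · simp only [dif_pos hT]
      exact (hmain T hT).choose_spec.1
    · refine ⟨fun N => (hD0ex T hT N).choose, fun N => ?_, ?_⟩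
      · -- any steady family has the reference family's response quotients near δ = 0 (uniqueness)
        refine ((hD0ex T hT N).choose_spec).congr' ?_
        have hball : Set.Ioo (-(2 * T)) (2 * T) ∈ nhds (0 : ℝ) := Ioo_mem_nhds (by linarith) (by linarith)
        filter_upwards [mem_nhdsWithin_of_mem_nhds hball] with δ hδ
        have h1 : 0 < T + δ / 2 := by linarith [hδ.1]
        have h2 : 0 < T - δ / 2 := by linarith [hδ.2]
        rw [huniq N _ _ h1 h2 _ _ (hμ N _ _ h1 h2) (hμ0 N _ _ h1 h2)]
      · simp only [dif_pos hT]
        exact (hmain T hT).choose_spec.2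

end Summit.AtomisticToContinuum.FouriersLaw.Theses.VanishingNoiseTransfer
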